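import Summits.KontsevichZagierPeriods.KontsevichZagierPeriods.Theorems.IsogenyCertificatesXMapPeriodTransferStubCubicComponents
import Summits.KontsevichZagierPeriods.KontsevichZagierPeriods.Theorems.IsogenyCertificatesXMapKernelStubDatumOfRatMult
import Literature.NumberTheory.EllipticCurves.RealLatticeRealLocusProofs
import Literature.NumberTheory.EllipticCurves.RealLatticeCovolumeProofs
import Literature.NumberTheory.EllipticCurves.UniformizationUniqueProofs
import Mathlib.Analysis.Calculus.LocalExtr.Rolle

/-!
# `XMapKernel`, line `derived-datum-quasi-periods` — stub `stub_eggBridge` (H3, the bridge)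

Support file for the crux `IsogenyCertificates.XMapKernel` (stmt-KontsevichZagierPeriods-10663),
line `derived-datum-quasi-periods`, stub `stub_eggBridge`: the BRIDGE hypothesis (H3) of the
conditional η-independence `EtaIndependence.stub_etaIndependence_of`.

**Statement.** Let `x³ + Ax + B`, `x³ + A'x + B'` be integral cubics with three real roots
(`4A³ + 27B² < 0`, `4A'³ + 27B'² < 0`), `Λ, Λ'` period lattices with `g₂ = −4A, g₃ = −4B`,
`g₂' = −4A', g₃' = −4B'` (normalisation `℘ = x`), and `c ∈ ℚˣ` with `cΛ ⊆ Λ'`. Then there is a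
COPRIME x-rational isogeny datum `(f, g, c₁)` (`W = f'g − fg' ≠ 0`,
`c₁²·g·(f³ + A₂fg² + B₂g³) = (X³ + A₁X + B₁)·W²`) whose denominator `g` has no zero on the CLOSED
egg of the source cubic, from `(A, B)` to `(A', B')` or from `(A', B')` to `(A, B)`.

**Proof.** Both lattices are real (uniqueness of uniformisation) and rectangular
(`g₂³ − 27g₃² = −16(4A³ + 27B²) > 0`): `Λ = ℤΩ₀ ⊕ ℤ·iΩ₀ⁱ` with `Ω₀`, `Ω₀ⁱ` the least positive
real periods of `Λ` and `iΛ`. A real `γ` with `γΩ₀ = n₁Ω₀'`, `γΩ₀ⁱ = n₂Ω₀ⁱ'` (`nᵢ ∈ ℤ`) maps `Λ`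
into `Λ'`; for `c` both hold, and halving `c` while `n₁, n₂` are both even (strong induction on
`|n₂|`) we reach `n₁` or `n₂` odd. If `n₂` is odd we use `γ = c : Λ → Λ'`; otherwise the dual
multiplier `γ = n₁n₂/c : Λ' → Λ` (`γΩ₀' = n₂Ω₀`, `γΩ₀ⁱ' = n₁Ω₀ⁱ`), for which the roles of `n₁, n₂`
swap — this decides the disjunct. For `γ : Λ₁ → Λ₂` with odd imaginary index `n` the datum is
that of the previous line's `stub_datumOfRatMult`: `Λ₁ ⊆ Λ₂'' := γ⁻¹Λ₂`, the descended
transformation `℘_{Λ₂''}·Q₀(℘_{Λ₁}) = P₀(℘_{Λ₁})`, `P₀, Q₀ ∈ ℚ[X]` coprime with `Q₀(℘_{Λ₁} z) ≠ 0`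
for `z ∉ Λ₂''` (`PeriodPair.exists_rat_polynomial_weierstrassP_mul_eval_eq_of_le`), the identity
`PeriodPair.transformation_polynomial_identity` pulled back to `ℚ[X]`, and `f = P₀`, `g = γ²Q₀`,
`c₁ = γ`. POLE CONTROL: the closed egg `[e₃, e₂]` is the image under `℘_{Λ₁}` of the half-period
line `w + ℝ`, `w = iΩ₀ⁱ/2` (`℘` is real there, `℘'(w) = ℘'(w + Ω₀/2) = 0`, `℘' ≠ 0` between, so
`℘(w) < ℘(w + Ω₀/2)` are roots bounding an interval inside `{x³ + Ax + B > 0}`, which is the egg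
by the landed `stub_cubicComponents`; Lawden §§6.11–6.12). A zero `y ∈ [e₃, e₂]` of `Q₀` is thus
`℘_{Λ₁}(w + t)`, forcing `γ(w + t) ∈ Λ₂`, whose imaginary part `nΩ₀ⁱ'/2` must lie in `ℤΩ₀ⁱ'`
(rectangularity of `Λ₂`) — impossible for odd `n`. No new definitions; no named facts are used.

References: Silverman, *The Arithmetic of Elliptic Curves* (2009), Thm. VI.4.1, VI.5.3;
Lawden, *Elliptic Functions and Applications* (1989), §§6.11–6.12, 6.15–6.16.
-/
noncomputable section

namespace Summit.KontsevichZagierPeriods.IsogenyCertificates.XMapKernelStubs.EggBridge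

open Polynomial Set Complex PeriodPair

/-! ### Real rectangular lattices: the invariants `g₂ = −4A`, `g₃ = −4B` -/

/-- Three real roots: `g₂³ − 27g₃² = −16(4A³ + 27B²) > 0` for `g₂ = −4A`, `g₃ = −4B`. [folklore] -/
theorem discr_pos {A B : ℤ} {L : PeriodPair} (h : 4 * A ^ 3 + 27 * B ^ 2 < 0)
    (hg₂ : L.g₂ = -4 * (A : ℂ)) (hg₃ : L.g₃ = -4 * (B : ℂ)) :
    0 < L.g₂.re ^ 3 - 27 * L.g₃.re ^ 2 := by
  have e₂ : L.g₂.re = -4 * (A : ℝ) := by rw [hg₂]; simp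
  have e₃ : L.g₃.re = -4 * (B : ℝ) := by rw [hg₃]; simp
  rw [e₂, e₃]
  have : ((4 * A ^ 3 + 27 * B ^ 2 : ℤ) : ℝ) < 0 := by exact_mod_cast h
  push_cast at this
  nlinarith

/-- A lattice with `g₂ = −4A`, `g₃ = −4B` (`A, B ∈ ℤ`) is real: uniqueness of uniformisation
(`PeriodPair.isReal_of_g₂_g₃_real`, `PeriodPair.uniformization_unique_holds`). [folklore] -/
theorem isReal_of_invariants {A B : ℤ} {L : PeriodPair} (hg₂ : L.g₂ = -4 * (A : ℂ))
    (hg₃ : L.g₃ = -4 * (B : ℂ)) : L.IsReal :=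
  isReal_of_g₂_g₃_real uniformization_unique_holds (by rw [hg₂]; simp) (by rw [hg₃]; simp)

/-! ### Rectangular lattices: `Λ = ℤΩ₀ ⊕ ℤ·iΩ₀ⁱ` and the half-period line `iΩ₀ⁱ/2 + ℝ` -/

/-- **Imaginary parts of a rectangular real lattice**: if `Λ` is real with `g₂³ − 27g₃² > 0` then
`im z ∈ ℤΩ₀ⁱ` for every `z ∈ Λ`, `Ω₀ⁱ` the least positive real period of `iΛ` (the tree's
`IsReal.exists_re_eq_int_mul_of_discr_pos` for the real lattice `iΛ`, which has the same
discriminant, applied to `iz`; Lawden §6.16). [folklore] -/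
theorem exists_im_eq_int_mul {L : PeriodPair} (h : L.IsReal)
    (hdisc : 0 < L.g₂.re ^ 3 - 27 * L.g₃.re ^ 2) {z : ℂ} (hz : z ∈ L.lattice) :
    ∃ k : ℤ, z.im = k * (L.mulLeft I I_ne_zero).minRealPeriod := by
  have hdisc' : 0 < (L.mulLeft I I_ne_zero).g₂.re ^ 3 - 27 * (L.mulLeft I I_ne_zero).g₃.re ^ 2 := by
    rw [g₂_mulLeft_I, g₃_mulLeft_I, Complex.neg_re, neg_sq]
    exact hdisc
  obtain ⟨k, hk⟩ := h.mulLeft_I.exists_re_eq_int_mul_of_discr_pos hdisc'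
    (mul_mem_mulLeft_lattice.mpr hz)
  refine ⟨-k, ?_⟩
  have e : (I * z).re = -z.im := by simp
  rw [e] at hk
  push_cast
  linarith

/-- **The half-period line misses a rectangular lattice**: for `Λ` real with `g₂³ − 27g₃² > 0`
and `w = iΩ₀ⁱ/2`, `w + t ∉ Λ` for every real `t` (`re (w + t) = t ∈ ℤΩ₀` would put `w` in `Λ`,
but `Ω₀ⁱ/2` is not a period of `iΛ`; Lawden §6.11). [folklore] -/
theorem line_notMem {L : PeriodPair} (h : L.IsReal)
    (hdisc : 0 < L.g₂.re ^ 3 - 27 * L.g₃.re ^ 2) (t : ℝ) :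
    I * ((((L.mulLeft I I_ne_zero).minRealPeriod / 2 : ℝ)) : ℂ) + t ∉ L.lattice := by
  obtain ⟨-, hwn, -⟩ := h.two_mul_halfPeriodI_mem
  intro ht
  obtain ⟨k, hk⟩ := h.exists_re_eq_int_mul_of_discr_pos hdisc ht
  have hre : (I * ((((L.mulLeft I I_ne_zero).minRealPeriod / 2 : ℝ)) : ℂ) + t).re = t := by simp
  rw [hre] at hk
  apply hwn
  have hsub := sub_mem ht (intCast_mul_mem h.minRealPeriod_mem_lattice k)
  convert hsub using 1
  rw [show (t : ℂ) = ((k * L.minRealPeriod : ℝ) : ℂ) by rw [hk]]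
  push_cast
  ring

/-- **Real multipliers between rectangular lattices**: if `Λ` (real, `g₂³ − 27g₃² > 0`) and `Λ'`
(real) have least positive real periods `Ω₀, Ω₀'` and `iΛ, iΛ'` have least positive real periods
`Ω₀ⁱ, Ω₀ⁱ'`, and `γ ∈ ℝ` satisfies `γΩ₀ = n₁Ω₀'`, `γΩ₀ⁱ = n₂Ω₀ⁱ'` with `n₁, n₂ ∈ ℤ`, then
`γΛ ⊆ Λ'` (`Λ = ℤΩ₀ ⊕ ℤ·iΩ₀ⁱ`; Lawden §6.16). [folklore] -/
theorem mul_mem_of_eq {L L' : PeriodPair} (h : L.IsReal)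
    (hdisc : 0 < L.g₂.re ^ 3 - 27 * L.g₃.re ^ 2) (h' : L'.IsReal) {γ : ℝ} {n₁ n₂ : ℤ}
    (h₁ : γ * L.minRealPeriod = n₁ * L'.minRealPeriod)
    (h₂ : γ * (L.mulLeft I I_ne_zero).minRealPeriod = n₂ * (L'.mulLeft I I_ne_zero).minRealPeriod) :
    ∀ l ∈ L.lattice, (γ : ℂ) * l ∈ L'.lattice := by
  intro l hl
  obtain ⟨a, ha⟩ := h.exists_re_eq_int_mul_of_discr_pos hdisc hl
  obtain ⟨b, hb⟩ := exists_im_eq_int_mul h hdisc hl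
  have h₁' := congrArg (fun r : ℝ => (r : ℂ)) h₁
  have h₂' := congrArg (fun r : ℝ => (r : ℂ)) h₂
  push_cast at h₁' h₂'
  have key : (γ : ℂ) * l = ((a * n₁ : ℤ) : ℂ) * (L'.minRealPeriod : ℂ) +
      ((b * n₂ : ℤ) : ℂ) * (I * ((L'.mulLeft I I_ne_zero).minRealPeriod : ℂ)) := by
    rw [← Complex.re_add_im l, ha, hb]
    push_cast
    linear_combination (a : ℂ) * h₁' + (b : ℂ) * I * h₂'
  rw [key]
  exact add_mem (intCast_mul_mem h'.minRealPeriod_mem_lattice _)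
    (intCast_mul_mem h'.I_mul_minRealPeriod_mem _)

/-! ### The closed egg is the image of the half-period line `iΩ₀ⁱ/2 + ℝ` under `℘` -/

/-- **`℘` maps the egg line onto the closed egg** (Lawden §§6.11–6.12, rectangular case). Let
`Λ` be real with `g₂ = −4A`, `g₃ = −4B`, `g₂³ − 27g₃² > 0`, and `w = iΩ₀ⁱ/2`. Then every point of
the closed egg `closure ({P > 0} ∖ unbounded component)` of `P = x³ + Ax + B` is a value
`℘(w + t)`, `t ∈ ℝ`. Proof: on `w + ℝ` (which misses `Λ`) `℘, ℘'` are real,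
`(re ℘')² = 4P(re ℘)`, `℘'(w) = ℘'(w + Ω₀/2) = 0` and `℘' ≠ 0` on `w + (0, Ω₀/2)`; so
`u = ℘(w)`, `v = ℘(w + Ω₀/2)` are roots of `P`, distinct (Rolle), `u ≤ v` (the cubic is negative
below `℘(w)`, `IsReal.cubic_neg_of_lt`), `(u, v) ⊆ ℘(w + (0, Ω₀/2)) ⊆ {P > 0}` (intermediate
values), hence `(u, v)` is the egg (`stub_cubicComponents`), its closure `[u, v]` is covered by
`℘(w + [0, Ω₀/2])`. [cite: Lawden1989, §6.11–§6.12] -/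
theorem exists_line_eq {A B : ℤ} {L : PeriodPair} (hΔ : 4 * A ^ 3 + 27 * B ^ 2 ≠ 0)
    (h : L.IsReal) (hdisc : 0 < L.g₂.re ^ 3 - 27 * L.g₃.re ^ 2)
    (hg₂ : L.g₂ = -4 * (A : ℂ)) (hg₃ : L.g₃ = -4 * (B : ℂ)) {y : ℝ}
    (hy : y ∈ closure ({y : ℝ | 0 < y ^ 3 + (A : ℝ) * y + (B : ℝ)} \
      connectedComponentIn {y : ℝ | 0 < y ^ 3 + (A : ℝ) * y + (B : ℝ)}
        (1 + |(A : ℝ)| + |(B : ℝ)|))) :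
    ∃ t : ℝ, ℘[L] (I * ((((L.mulLeft I I_ne_zero).minRealPeriod / 2 : ℝ)) : ℂ) + t) = y := by
  obtain ⟨h2w, -, hcw⟩ := h.two_mul_halfPeriodI_mem
  set w : ℂ := I * ((((L.mulLeft I I_ne_zero).minRealPeriod / 2 : ℝ)) : ℂ) with hw
  have hline : ∀ t : ℝ, w + t ∉ L.lattice := line_notMem h hdisc
  set T : ℝ := L.minRealPeriod / 2 with hT
  have hT0 : 0 < T := by have := h.minRealPeriod_pos; positivity
  set φ : ℝ → ℝ := fun s => (℘[L] (w + s)).re with hφ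
  set ψ : ℝ → ℝ := fun s => (℘'[L] (w + s)).re with hψ
  have hder : ∀ s, HasDerivAt φ (ψ s) s := fun s => hasDerivAt_weierstrassP_line_re (hline s)
  have hφc : Continuous φ := continuous_iff_continuousAt.mpr fun s => (hder s).continuousAt
  have hval : ∀ s : ℝ, ℘[L] (w + s) = ((φ s : ℝ) : ℂ) := fun s =>
    Complex.ext (by simp [hφ]) (by rw [Complex.ofReal_im]; exact h.weierstrassP_line_im h2w hcw s)
  have hf : ∀ x : ℝ, 4 * x ^ 3 - L.g₂.re * x - L.g₃.re = 4 * (x ^ 3 + (A : ℝ) * x + (B : ℝ)) := by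
    intro x
    rw [hg₂, hg₃]
    simp only [Complex.mul_re, Complex.neg_re, Complex.re_ofNat, Complex.intCast_re,
      Complex.neg_im, Complex.im_ofNat, Complex.intCast_im, mul_zero, sub_zero, neg_zero]
    ring
  have hsq : ∀ s, ψ s ^ 2 = 4 * (φ s ^ 3 + (A : ℝ) * φ s + (B : ℝ)) := fun s => by
    rw [← hf]; exact h.derivWeierstrassP_line_re_sq h2w hcw (hline s)
  have hψne : ∀ s ∈ Ioo 0 T, ψ s ≠ 0 := by
    intro s hs h0
    refine h.derivWeierstrassP_line_ne_zero h2w (hline s) hs.1 hs.2 ?_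
    exact Complex.ext (by simpa [hψ] using h0) (by simp [h.derivWeierstrassP_line_im h2w hcw s])
  have hψ0 : ψ 0 = 0 := by
    simp only [hψ, Complex.ofReal_zero, add_zero]
    rw [derivWeierstrassP_eq_zero_of_two_mul_mem h2w, Complex.zero_re]
  have hψT : ψ T = 0 := by
    simp only [hψ]
    rw [derivWeierstrassP_eq_zero_of_two_mul_mem, Complex.zero_re]
    rw [show 2 * (w + ((T : ℝ) : ℂ)) = 2 * w + (L.minRealPeriod : ℂ) by
      rw [hT]; push_cast; ring]
    exact add_mem h2w h.minRealPeriod_mem_lattice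
  have hroot0 : φ 0 ^ 3 + (A : ℝ) * φ 0 + (B : ℝ) = 0 := by
    have := hsq 0; rw [hψ0] at this; linarith
  have hrootT : φ T ^ 3 + (A : ℝ) * φ T + (B : ℝ) = 0 := by
    have := hsq T; rw [hψT] at this; linarith
  have hpos : ∀ s ∈ Ioo 0 T, 0 < φ s ^ 3 + (A : ℝ) * φ s + (B : ℝ) := fun s hs => by
    have h1 : 0 < ψ s ^ 2 := by have := hψne s hs; positivity
    rw [hsq] at h1
    linarith
  -- `φ 0 ≤ φ T`: the cubic is negative below `℘(w) = φ 0`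
  have hle : φ 0 ≤ φ T := by
    by_contra hlt
    push Not at hlt
    have hPw : φ 0 = -(L.mulLeft I I_ne_zero).weierstrassPRe
        ((L.mulLeft I I_ne_zero).minRealPeriod / 2) := by
      simp only [hφ, Complex.ofReal_zero, add_zero]
      rw [hw, weierstrassP_I_mul, Complex.neg_re]
      rfl
    have hneg := h.cubic_neg_of_lt (x := φ T) (by rw [← hPw]; exact hlt)
    rw [hf, hrootT] at hneg
    simp at hneg
  have hne : φ 0 ≠ φ T := by
    intro heq
    obtain ⟨s, hs, hs0⟩ := exists_hasDerivAt_eq_zero hT0 hφc.continuousOn heq fun s _ => hder s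
    exact hψne s hs hs0
  have hlt : φ 0 < φ T := lt_of_le_of_ne hle hne
  have hIoo : Ioo (φ 0) (φ T) ⊆ {y : ℝ | 0 < y ^ 3 + (A : ℝ) * y + (B : ℝ)} := by
    intro x hx
    obtain ⟨s, hs, rfl⟩ := intermediate_value_Ioo hT0.le hφc.continuousOn hx
    exact hpos s hs
  have hegg := (XMapPeriodTransferCells.stub_cubicComponents A B hΔ _ rfl _ hroot0).2 _ hrootT
    hlt hIoo
  rw [← hegg, closure_Ioo hlt.ne] at hy
  obtain ⟨s, -, hs⟩ := intermediate_value_Icc hT0.le hφc.continuousOn hy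
  exact ⟨s, by rw [hval, hs]⟩

/-! ### One direction: a multiplier with odd imaginary index gives an egg-regular coprime datum -/

/-- **Egg-regular coprime datum from a multiplier with odd imaginary index.** Let `Λ, Λ'` be real
rectangular lattices with `g₂ = −4A, g₃ = −4B`, `g₂' = −4A', g₃' = −4B'` (`A, B, A', B' ∈ ℤ`,
`4A³ + 27B² ≠ 0`), `γ ∈ ℚˣ` with `γΛ ⊆ Λ'` and `γΩ₀ⁱ = nΩ₀ⁱ'` with `n` ODD. Then there is a
coprime datum `(f, g, c₁)` from `(A, B)` to `(A', B')`, `W ≠ 0`,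
`c₁²·g·(f³ + A'fg² + B'g³) = (X³ + AX + B)·W²`, with `g ≠ 0` on the closed egg of
`x³ + Ax + B`: `f = P₀`, `g = γ²Q₀`, `c₁ = γ` with `P₀/Q₀ ∈ ℚ(X)` the descended `x`-coordinate of
`z ↦ z : ℂ/Λ → ℂ/γ⁻¹Λ'` (`PeriodPair.exists_rat_polynomial_weierstrassP_mul_eval_eq_of_le`,
`PeriodPair.transformation_polynomial_identity`, as in the landed `stub_datumOfRatMult`), whose
denominator only vanishes at `℘_Λ` of points of `γ⁻¹Λ'`; a zero on the closed egg would be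
`℘_Λ(w + t)` (`exists_line_eq`), giving `γ(w + t) ∈ Λ'` with imaginary part `nΩ₀ⁱ'/2 ∉ ℤΩ₀ⁱ'`.
[cite: SilvermanAEC2009, Thm. VI.4.1] -/
theorem eggDatum_of_odd {A B A' B' : ℤ} {L L' : PeriodPair} (hΔ : 4 * A ^ 3 + 27 * B ^ 2 ≠ 0)
    (hreal : L.IsReal) (hreal' : L'.IsReal) (hdisc : 0 < L.g₂.re ^ 3 - 27 * L.g₃.re ^ 2)
    (hdisc' : 0 < L'.g₂.re ^ 3 - 27 * L'.g₃.re ^ 2) (hg₂ : L.g₂ = -4 * (A : ℂ))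
    (hg₃ : L.g₃ = -4 * (B : ℂ)) (hg₂' : L'.g₂ = -4 * (A' : ℂ)) (hg₃' : L'.g₃ = -4 * (B' : ℂ))
    {γ : ℚ} (hγ : γ ≠ 0) (hmul : ∀ l ∈ L.lattice, (γ : ℂ) * l ∈ L'.lattice) {n : ℤ} (hn : Odd n)
    (hγn : (γ : ℝ) * (L.mulLeft I I_ne_zero).minRealPeriod =
      n * (L'.mulLeft I I_ne_zero).minRealPeriod) :
    ∃ (f g : Polynomial ℚ) (c : ℚ), IsCoprime f g ∧
      Polynomial.derivative f * g - f * Polynomial.derivative g ≠ 0 ∧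
      Polynomial.C (c ^ 2) * g * (f ^ 3 + Polynomial.C ((A' : ℤ) : ℚ) * f * g ^ 2 +
        Polynomial.C ((B' : ℤ) : ℚ) * g ^ 3) =
        (Polynomial.X ^ 3 + Polynomial.C ((A : ℤ) : ℚ) * Polynomial.X +
          Polynomial.C ((B : ℤ) : ℚ)) *
          (Polynomial.derivative f * g - f * Polynomial.derivative g) ^ 2 ∧
      ∀ y ∈ closure ({y : ℝ | 0 < y ^ 3 + (A : ℝ) * y + (B : ℝ)} \
        connectedComponentIn {y : ℝ | 0 < y ^ 3 + (A : ℝ) * y + (B : ℝ)}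
          (1 + |(A : ℝ)| + |(B : ℝ)|)), Polynomial.aeval y g ≠ 0 := by
  have hγinv : (γ : ℂ)⁻¹ ≠ 0 := inv_ne_zero (by exact_mod_cast hγ)
  -- the lattice `Λ'' = γ⁻¹ Λ' ⊇ Λ`, with invariants `γ⁴ g₂'`, `γ⁶ g₃'`
  obtain ⟨L'', hle, hG₂, hG₃, hmem⟩ : ∃ L'' : PeriodPair, L.lattice ≤ L''.lattice ∧
      L''.g₂ = (γ : ℂ) ^ 4 * (-4 * (A' : ℂ)) ∧ L''.g₃ = (γ : ℂ) ^ 6 * (-4 * (B' : ℂ)) ∧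
      ∀ z, z ∈ L''.lattice ↔ (γ : ℂ) * z ∈ L'.lattice := by
    refine ⟨L'.mulLeft (γ : ℂ)⁻¹ hγinv, fun x hx => ?_, ?_, ?_, fun z => ?_⟩
    · rw [mem_mulLeft_lattice, inv_inv]
      exact hmul x hx
    · rw [g₂_mulLeft, hg₂', inv_pow, inv_inv]
    · rw [g₃_mulLeft, hg₃', inv_pow, inv_inv]
    · rw [mem_mulLeft_lattice, inv_inv]
  have h₂ : ∃ q : ℚ, (q : ℂ) = L.g₂ := ⟨-4 * A, by rw [hg₂]; push_cast; ring⟩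
  have h₃ : ∃ q : ℚ, (q : ℂ) = L.g₃ := ⟨-4 * B, by rw [hg₃]; push_cast; ring⟩
  have h₂' : ∃ q : ℚ, (q : ℂ) = L''.g₂ := ⟨γ ^ 4 * (-4 * A'), by rw [hG₂]; push_cast; ring⟩
  have h₃' : ∃ q : ℚ, (q : ℂ) = L''.g₃ := ⟨γ ^ 6 * (-4 * B'), by rw [hG₃]; push_cast; ring⟩
  obtain ⟨P₀, Q₀, hmon, hcop, hQ, hPQ⟩ :=
    L.exists_rat_polynomial_weierstrassP_mul_eval_eq_of_le L'' hle h₂ h₃ h₂' h₃'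
  have hinj : Function.Injective (algebraMap ℚ ℂ) := (algebraMap ℚ ℂ).injective
  have hdeg : Q₀.natDegree < P₀.natDegree := by
    have hd := L.natDegree_lt_of_weierstrassP_mul_eval_eq L'' (hmon.map _).ne_zero hPQ
    rwa [natDegree_map_eq_of_injective hinj, natDegree_map_eq_of_injective hinj] at hd
  have hid := L.transformation_polynomial_identity L'' hle hPQ
  rw [hg₂, hg₃, hG₂, hG₃] at hid
  simp only [derivative_map, C_mul, C_neg, C_pow, map_ofNat] at hid
  have hidQ : (derivative P₀ * Q₀ - P₀ * derivative Q₀) ^ 2 * (X ^ 3 + C (A : ℚ) * X + C (B : ℚ)) =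
      Q₀ * (P₀ ^ 3 + C γ ^ 4 * C (A' : ℚ) * P₀ * Q₀ ^ 2 + C γ ^ 6 * C (B' : ℚ) * Q₀ ^ 3) := by
    apply mul_left_cancel₀ (by norm_num : (4 : ℚ[X]) ≠ 0)
    apply Polynomial.map_injective (algebraMap ℚ ℂ) hinj
    simp only [Polynomial.map_mul, Polynomial.map_add, Polynomial.map_sub, Polynomial.map_pow,
      Polynomial.map_C, Polynomial.map_X, Polynomial.map_ofNat, eq_ratCast, Rat.cast_intCast]
    linear_combination hid
  have hW₀ : derivative P₀ * Q₀ - P₀ * derivative Q₀ ≠ 0 :=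
    DatumOfRatMult.wronskian_ne_zero hcop hdeg
  have hW : derivative P₀ * (C (γ ^ 2) * Q₀) - P₀ * (C (γ ^ 2) * derivative Q₀) =
      C (γ ^ 2) * (derivative P₀ * Q₀ - P₀ * derivative Q₀) := by ring
  refine ⟨P₀, C (γ ^ 2) * Q₀, γ, ?_, ?_, ?_, ?_⟩
  · exact (isCoprime_mul_unit_left_right (isUnit_C.mpr (IsUnit.mk0 _ (pow_ne_zero 2 hγ))) _ _).mpr
      hcop
  · rw [derivative_C_mul, hW]
    exact mul_ne_zero (C_ne_zero.mpr (pow_ne_zero 2 hγ)) hW₀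
  · rw [derivative_C_mul, hW, C_pow]
    linear_combination (-(C γ ^ 4)) * hidQ
  · -- egg-regularity: the denominator has no zero on the closed egg
    intro y hy
    obtain ⟨t, ht⟩ := exists_line_eq hΔ hreal hdisc hg₂ hg₃ hy
    rw [map_mul, aeval_C, eq_ratCast]
    refine mul_ne_zero (by exact_mod_cast pow_ne_zero 2 hγ) fun h0 => ?_
    have hwt : I * ((((L.mulLeft I I_ne_zero).minRealPeriod / 2 : ℝ)) : ℂ) + t ∉ L''.lattice := by
      intro hwt
      rw [hmem] at hwt
      obtain ⟨k, hk⟩ := exists_im_eq_int_mul hreal' hdisc' hwt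
      have him : ((γ : ℂ) * (I * ((((L.mulLeft I I_ne_zero).minRealPeriod / 2 : ℝ)) : ℂ) + t)).im =
          (γ : ℝ) * ((L.mulLeft I I_ne_zero).minRealPeriod / 2) := by
        simp
      rw [him] at hk
      have hpos' := hreal'.mulLeft_I.minRealPeriod_pos
      have h2 : ((n : ℝ) - 2 * k) * (L'.mulLeft I I_ne_zero).minRealPeriod = 0 := by
        linear_combination 2 * hk - hγn
      have h3 : (n : ℝ) - 2 * k = 0 := by
        rcases mul_eq_zero.mp h2 with h4 | h4
        · exact h4
        · exact absurd h4 hpos'.ne'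
      have h4 : n = 2 * k := by exact_mod_cast sub_eq_zero.mp h3
      exact (Int.not_even_iff_odd.mpr hn) ⟨k, by rw [h4]; ring⟩
    refine hQ _ hwt ?_
    rw [ht, eval_map_algebraMap, show ((y : ℝ) : ℂ) = algebraMap ℝ ℂ y from rfl,
      aeval_algebraMap_apply, h0, map_zero]

/-! ### The bridge -/

/-- **H3 — the bridge** (stub `stub_eggBridge` of the line `derived-datum-quasi-periods`, crux
`XMapKernel`): for two three-real-root integral cubics `x³ + Ax + B`, `x³ + A'x + B'`
(`4A³ + 27B² < 0`, `4A'³ + 27B'² < 0`) whose period lattices `Λ` (`g₂ = −4A`, `g₃ = −4B`) and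
`Λ'` (`g₂ = −4A'`, `g₃ = −4B'`) admit a rational multiplier `c ≠ 0`, `cΛ ⊆ Λ'`, there is an
egg-regular COPRIME x-rational isogeny datum from `(A, B)` to `(A', B')` or from `(A', B')` to
`(A, B)`. Proof: both lattices are real and rectangular; write `cΩ₀ = n₁Ω₀'`, `cΩ₀ⁱ = n₂Ω₀ⁱ'`;
by strong induction on `|n₂|`, halve `c` while `n₁, n₂` are both even (`mul_mem_of_eq`), then
apply `eggDatum_of_odd` to `c : Λ → Λ'` if `n₂` is odd and to the dual multiplier
`n₁n₂/c : Λ' → Λ` (imaginary index `n₁`) if `n₁` is odd. (Silverman, *AEC*, Thm. VI.4.1 with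
III.6.1 for the dual; Lawden §§6.11–6.16 for the real picture.)
[cite: SilvermanAEC2009, Thm. VI.4.1] -/
theorem stub_eggBridge : ∀ (A B A' B' : ℤ), 4 * A ^ 3 + 27 * B ^ 2 < 0 → 4 * A' ^ 3 + 27 * B' ^ 2 < 0 → ∀ (L L' : PeriodPair) (c : ℚ), L.g₂ = -4 * (A : ℂ) → L.g₃ = -4 * (B : ℂ) → L'.g₂ = -4 * (A' : ℂ) → L'.g₃ = -4 * (B' : ℂ) → c ≠ 0 → (∀ l ∈ L.lattice, (c : ℂ) * l ∈ L'.lattice) → (∃ (f g : Polynomial ℚ) (c : ℚ), IsCoprime f g ∧ Polynomial.derivative f * g - f * Polynomial.derivative g ≠ 0 ∧ Polynomial.C (c ^ 2) * g * (f ^ 3 + Polynomial.C ((A' : ℤ) : ℚ) * f * g ^ 2 + Polynomial.C ((B' : ℤ) : ℚ) * g ^ 3) = (Polynomial.X ^ 3 + Polynomial.C ((A : ℤ) : ℚ) * Polynomial.X + Polynomial.C ((B : ℤ) : ℚ)) * (Polynomial.derivative f * g - f * Polynomial.derivative g) ^ 2 ∧ ∀ y ∈ closure ({y : ℝ | 0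 < y ^ 3 + (A : ℝ) * y + (B : ℝ)} \ connectedComponentIn {y : ℝ | 0 < y ^ 3 + (A : ℝ) * y + (B : ℝ)} (1 + |(A : ℝ)| + |(B : ℝ)|)), Polynomial.aeval y g ≠ 0) ∨ (∃ (f g : Polynomial ℚ) (c : ℚ), IsCoprime f g ∧ Polynomial.derivative f * g - f * Polynomial.derivative g ≠ 0 ∧ Polynomial.C (c ^ 2) * g * (f ^ 3 + Polynomial.C ((A : ℤ) : ℚ) * f * g ^ 2 + Polynomial.C ((B : ℤ) : ℚ) * g ^ 3) = (Polynomial.X ^ 3 + Polynomial.C ((A' : ℤ) : ℚ) * Polynomial.X + Polynomial.C ((B' : ℤ) : ℚ)) * (Polynomial.derivative f * g - f * Polynomial.derivative g) ^ 2 ∧ ∀ y ∈ closure ({y : ℝ | 0 < y ^ 3 + (A' : ℝ) * y + (B' : ℝ)} \ connectedComponentIn {y : ℝ | 0 < y ^ 3 + (A' : ℝ) * y + (B' : ℝ)} (1 + |(A' : ℝ)| + |(B' : ℝ)|)), Polynomial.aeval y g ≠ 0) := by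
  intro A B A' B' hΔ hΔ' L L' c hg₂ hg₃ hg₂' hg₃' hc hmul
  have hreal : L.IsReal := isReal_of_invariants hg₂ hg₃
  have hreal' : L'.IsReal := isReal_of_invariants hg₂' hg₃'
  have hdisc := discr_pos hΔ hg₂ hg₃
  have hdisc' := discr_pos hΔ' hg₂' hg₃'
  have hΩ := hreal.minRealPeriod_pos
  have hΩi := hreal.mulLeft_I.minRealPeriod_pos
  -- `cΩ₀ = n₁Ω₀'`, `cΩ₀ⁱ = n₂Ω₀ⁱ'`
  obtain ⟨n₁, hn₁⟩ : ∃ n₁ : ℤ, (c : ℝ) * L.minRealPeriod = n₁ * L'.minRealPeriod :=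
    hreal'.exists_eq_int_mul (by push_cast; exact hmul _ hreal.minRealPeriod_mem_lattice)
  obtain ⟨n₂, hn₂⟩ : ∃ n₂ : ℤ, (c : ℝ) * (L.mulLeft I I_ne_zero).minRealPeriod =
      n₂ * (L'.mulLeft I I_ne_zero).minRealPeriod := by
    have h1 : I * ((c : ℂ) * (I * ((L.mulLeft I I_ne_zero).minRealPeriod : ℂ))) ∈
        (L'.mulLeft I I_ne_zero).lattice :=
      mul_mem_mulLeft_lattice.mpr (hmul _ hreal.I_mul_minRealPeriod_mem)
    have h2 : ((-((c : ℝ) * (L.mulLeft I I_ne_zero).minRealPeriod) : ℝ) : ℂ) ∈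
        (L'.mulLeft I I_ne_zero).lattice := by
      convert h1 using 1
      push_cast
      linear_combination -((c : ℂ) * ((L.mulLeft I I_ne_zero).minRealPeriod : ℂ)) * Complex.I_sq
    obtain ⟨k, hk⟩ := hreal'.mulLeft_I.exists_eq_int_mul h2
    exact ⟨-k, by push_cast; linarith⟩
  clear hmul
  -- strong induction on `|n₂|`: halve `c` while `n₁, n₂` are both even
  generalize hm : n₂.natAbs = m
  induction m using Nat.strong_induction_on generalizing c n₁ n₂ with
  | _ m ih => ?_
  have hn₂0 : n₂ ≠ 0 := by
    rintro rfl
    have h0 : (c : ℝ) * (L.mulLeft I I_ne_zero).minRealPeriod = 0 := by simpa using hn₂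
    rcases mul_eq_zero.mp h0 with h | h
    · exact hc (by exact_mod_cast h)
    · exact hΩi.ne' h
  have hn₁0 : n₁ ≠ 0 := by
    rintro rfl
    have h0 : (c : ℝ) * L.minRealPeriod = 0 := by simpa using hn₁
    rcases mul_eq_zero.mp h0 with h | h
    · exact hc (by exact_mod_cast h)
    · exact hΩ.ne' h
  rcases Int.even_or_odd n₂ with ⟨j₂, hj₂⟩ | hodd₂
  · rcases Int.even_or_odd n₁ with ⟨j₁, hj₁⟩ | hodd₁
    · -- both even: replace `c` by `c/2`
      have hlt : j₂.natAbs < m := by omega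
      refine ih _ hlt (c / 2) (div_ne_zero hc two_ne_zero) j₁ ?_ j₂ ?_ rfl
      · rw [hj₁] at hn₁
        push_cast at hn₁ ⊢
        linarith
      · rw [hj₂] at hn₂
        push_cast at hn₂ ⊢
        linarith
    · -- `n₂` even, `n₁` odd: the dual multiplier `n₁n₂/c : Λ' → Λ`
      right
      have hcR : (c : ℝ) ≠ 0 := by exact_mod_cast hc
      have hc' : ((n₁ * n₂ : ℤ) : ℚ) / c ≠ 0 :=
        div_ne_zero (by exact_mod_cast mul_ne_zero hn₁0 hn₂0) hc
      have e₁ : ((((n₁ * n₂ : ℤ) : ℚ) / c : ℚ) : ℝ) * L'.minRealPeriod = n₂ * L.minRealPeriod := by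
        push_cast
        rw [div_mul_eq_mul_div, div_eq_iff hcR]
        linear_combination (-(n₂ : ℝ)) * hn₁
      have e₂ : ((((n₁ * n₂ : ℤ) : ℚ) / c : ℚ) : ℝ) * (L'.mulLeft I I_ne_zero).minRealPeriod =
          n₁ * (L.mulLeft I I_ne_zero).minRealPeriod := by
        push_cast
        rw [div_mul_eq_mul_div, div_eq_iff hcR]
        linear_combination (-(n₁ : ℝ)) * hn₂
      exact eggDatum_of_odd hΔ'.ne hreal' hreal hdisc' hdisc hg₂' hg₃' hg₂ hg₃ hc'
        (mul_mem_of_eq hreal' hdisc' hreal e₁ e₂) hodd₁ e₂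
  · left
    exact eggDatum_of_odd hΔ.ne hreal hreal' hdisc hdisc' hg₂ hg₃ hg₂' hg₃' hc
      (mul_mem_of_eq hreal hdisc hreal' hn₁ hn₂) hodd₂ hn₂

end Summit.KontsevichZagierPeriods.IsogenyCertificates.XMapKernelStubs.EggBridge

end
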